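import Summits.AtomisticToContinuum.Crystallization.Theorems.SquareWellLayerCakeStackingFaultSparsityLocalFramesStructureB
import Summits.AtomisticToContinuum.Crystallization.Theorems.SquareWellLayerCakeStackingFaultSparsityLocalFramesCounting
import Summits.AtomisticToContinuum.Crystallization.Theses.LaminarSixThreeThree

/-!
# Local frames: local rigidity by compactness + contradiction, and the registered stub `stub_leadGlue`

Crux `StackingFaultSparsity` (stmt-AtomisticToContinuum-14296), line `Sketch`, reshape 11, the lead's glue — part 3.

* `localRigidity_of_stubs` — the statements of S0 (`stub_localFrameLimit`), S12, S3, S4 imply LOCAL RIGIDITY: for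
  every `R` and `ε > 0` there is a radius `m` such that for every finite configuration, if every particle within `m`
  of `y i` carries a GOOD `(2, 1, 1/(m+1))`-window of its own, the `R`-window of `y i` is two-way `ε`-matched after a
  linear isometry to a window of some `barlowStacking a h s`, `a, h ∈ (1/2, 2)`.  Proof: otherwise `choose` a bad
  all-GOOD `m`-ball for every `m`; S0 gives a local limit `X ∋ 0` with exact local frames everywhere; the structure
  theorem `barlow_of_localFrames` (S12/S3/S4) makes `X` a moved Barlow stacking `g '' barlowStacking a h s`; writing
  the isometry affinely (`IsometryEquiv.toRealLinearIsometryEquiv`, Mazur–Ulam) the two-way matching at a scale `≥ R` reads back as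
  the forbidden Barlow window — contradiction.
* `stub_leadGlue` — the registered stub: local rigidity fed into the counting side
  `laminarBarlowWindows_of_localRigidity`.
All `[folklore]` bookkeeping.
-/

noncomputable section

namespace Summit.AtomisticToContinuum.Crystallization.Theorems.SquareWellLayerCake.StackingFaultSparsity.LocalFrames.Final

open Filter
open Literature.MathematicalPhysics.StatisticalMechanics
open Summit.AtomisticToContinuum.Crystallization.Theses.LaminarSixThreeThree
open Summit.AtomisticToContinuum.Crystallization.Theorems.SquareWellLayerCake.StackingFaultSparsity.LocalFrames.Structure
open Summit.AtomisticToContinuum.Crystallization.Theorems.SquareWellLayerCake.StackingFaultSparsity.LocalFrames.Counting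

/-- An isometry equivalence of `ℝ³` acts affinely: `g p = g z + L (p − z)` with `L` its linear part. [folklore] -/
theorem isometryEquiv_apply_eq :
    ∀ (g : EuclideanSpace ℝ (Fin 3) ≃ᵢ EuclideanSpace ℝ (Fin 3)) (p z : EuclideanSpace ℝ (Fin 3)), g p = g z + g.toRealLinearIsometryEquiv (p - z) := by
  intro g p z
  rw [map_sub, IsometryEquiv.toRealLinearIsometryEquiv_apply, IsometryEquiv.toRealLinearIsometryEquiv_apply]
  abel

/-- **Local rigidity from the geometric stubs** (see the module docstring). [folklore] -/
theorem localRigidity_of_stubs :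
    (∀ (Nk : ℕ → ℕ) (y : (m : ℕ) → Fin (Nk m) → EuclideanSpace ℝ (Fin 3)) (ik : (m : ℕ) → Fin (Nk m)), (∀ (m : ℕ) (jc : Fin (Nk m)), dist (y m jc) (y m (ik m)) ≤ (m : ℝ) → (∃ a b : ℝ, 19 / 20 ≤ a ∧ a ≤ 1 ∧ 19 / 20 ≤ b ∧ b ≤ 1 ∧ ∃ n : EuclideanSpace ℝ (Fin 3), ‖n‖ = 1 ∧ ∃ c : ℤ → ℝ, (∀ k : ℤ, c k + 19 / 25 ≤ c (k + 1)) ∧ ∃ l : Fin (Nk m) → ℤ, (∀ j : Fin (Nk m), dist (y m j) (y m jc) ≤ 2 → |inner ℝ (y m j - y m jc) n - c (l j)| ≤ 1 / ((m : ℝ) + 1)) ∧ (∀ j k : Fin (Nk m), dist (y m j) (y m jc) ≤ 2 → dist (y m k) (y m jc) ≤ 2 → j ≠ k → 19 / 20 ≤ dist (y m j) (y m k)) ∧ ∀ j : Fin (Nk m), dist (y m j) (y m jc) ≤ 1 → Nat.card {k : Fin (Nk m) // k ≠ j ∧ l k = l j ∧ dist (y m j) (y m k) ≤ 1} = 6 ∧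 Nat.card {k : Fin (Nk m) // l k = l j + 1 ∧ dist (y m j) (y m k) ≤ 1} = 3 ∧ Nat.card {k : Fin (Nk m) // l k = l j - 1 ∧ dist (y m j) (y m k) ≤ 1} = 3 ∧ ∀ k : Fin (Nk m), k ≠ j → dist (y m j) (y m k) ≤ 1 → (l k = l j → |dist (y m j) (y m k) - a| ≤ 1 / ((m : ℝ) + 1)) ∧ (l k ≠ l j → |dist (y m j) (y m k) - b| ≤ 1 / ((m : ℝ) + 1)))) → ∃ (φ : ℕ → ℕ) (X : Set (EuclideanSpace ℝ (Fin 3))), StrictMono φ ∧ (∀ R δ : ℝ, 0 < δ → ∀ᶠ k in Filter.atTop, Literature.MathematicalPhysics.StatisticalMechanics.BallMatch δ R 0 {p | ∃ j : Fin (Nk (φ k)), dist (y (φ k) j) (y (φ k) (ik (φ k))) ≤ (φ k : ℝ) ∧ p = y (φ k) j - y (φ k) (ik (φ k))} X) ∧ (0 : EuclideanSpace ℝ (Fin 3)) ∈ X ∧ ∀ p ∈ X, ∃ (a b : ℝ) (n : EuclideanSpace ℝ (Fin 3)) (c : ℤ → ℝ), (19 / 20 ≤ a ∧ a ≤ 1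 ∧ 19 / 20 ≤ b ∧ b ≤ 1 ∧ ‖n‖ = 1 ∧ c 0 = 0 ∧ (∀ k : ℤ, c k + 19 / 25 ≤ c (k + 1)) ∧ (∀ q ∈ X, ∀ r ∈ X, q ≠ r → 19 / 20 ≤ dist q r) ∧ (∀ q ∈ X, dist q p < 2 → ∃ k : ℤ, inner ℝ (q - p) n = c k) ∧ (∃ H U D : Finset (EuclideanSpace ℝ (Fin 3)), H.card = 6 ∧ U.card = 3 ∧ D.card = 3 ∧ (∀ q ∈ H, q ∈ X ∧ inner ℝ (q - p) n = 0 ∧ dist p q = a) ∧ (∀ q ∈ U, q ∈ X ∧ inner ℝ (q - p) n = c 1 ∧ dist p q = b) ∧ (∀ q ∈ D, q ∈ X ∧ inner ℝ (q - p) n = c (-1) ∧ dist p q = b) ∧ (∀ q ∈ X, q ≠ p → dist q p ≤ 1 → q ∈ H ∨ q ∈ U ∨ q ∈ D)) ∧ (∀ q ∈ X, q ≠ p → dist q p ≤ 1 → (∃ H' : Finset (EuclideanSpace ℝ (Fin 3)), H'.card = 6 ∧ ∀ r ∈ H', r ∈ X ∧ r ≠ q ∧ inner ℝ (r - p) n =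 inner ℝ (q - p) n ∧ dist q r = a) ∧ (∃ U' : Finset (EuclideanSpace ℝ (Fin 3)), U'.card = 3 ∧ ∀ r ∈ U', r ∈ X ∧ (∃ k : ℤ, inner ℝ (q - p) n = c k ∧ inner ℝ (r - p) n = c (k + 1)) ∧ dist q r = b) ∧ (∃ D' : Finset (EuclideanSpace ℝ (Fin 3)), D'.card = 3 ∧ ∀ r ∈ D', r ∈ X ∧ (∃ k : ℤ, inner ℝ (q - p) n = c k ∧ inner ℝ (r - p) n = c (k - 1)) ∧ dist q r = b) ∧ (∀ r ∈ X, r ≠ q → dist q r < 1 → (inner ℝ (r - p) n = inner ℝ (q - p) n → dist q r = a) ∧ (inner ℝ (r - p) n ≠ inner ℝ (q - p) n → dist q r = b))))) → (∀ (X : Set (EuclideanSpace ℝ (Fin 3))) (d : ℝ), X.Nonempty → (∀ p ∈ X, ∃ (n : EuclideanSpace ℝ (Fin 3)) (c : ℤ → ℝ), (19 / 20 ≤ d ∧ d ≤ 1 ∧ 19 / 20 ≤ d ∧ d ≤ 1 ∧ ‖n‖ = 1 ∧ c 0 = 0 ∧ (∀ k : ℤ, c k + 19 / 25 ≤ c (k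 + 1)) ∧ (∀ q ∈ X, ∀ r ∈ X, q ≠ r → 19 / 20 ≤ dist q r) ∧ (∀ q ∈ X, dist q p < 2 → ∃ k : ℤ, inner ℝ (q - p) n = c k) ∧ (∃ H U D : Finset (EuclideanSpace ℝ (Fin 3)), H.card = 6 ∧ U.card = 3 ∧ D.card = 3 ∧ (∀ q ∈ H, q ∈ X ∧ inner ℝ (q - p) n = 0 ∧ dist p q = d) ∧ (∀ q ∈ U, q ∈ X ∧ inner ℝ (q - p) n = c 1 ∧ dist p q = d) ∧ (∀ q ∈ D, q ∈ X ∧ inner ℝ (q - p) n = c (-1) ∧ dist p q = d) ∧ (∀ q ∈ X, q ≠ p → dist q p ≤ 1 → q ∈ H ∨ q ∈ U ∨ q ∈ D)) ∧ (∀ q ∈ X, q ≠ p → dist q p ≤ 1 → (∃ H' : Finset (EuclideanSpace ℝ (Fin 3)), H'.card = 6 ∧ ∀ r ∈ H', r ∈ X ∧ r ≠ q ∧ inner ℝ (r - p) n = inner ℝ (q - p) n ∧ dist q r = d) ∧ (∃ U' : Finset (EuclideanSpace ℝ (Fin 3)), U'.card = 3 ∧ ∀ r ∈ U', r ∈ X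 ∧ (∃ k : ℤ, inner ℝ (q - p) n = c k ∧ inner ℝ (r - p) n = c (k + 1)) ∧ dist q r = d) ∧ (∃ D' : Finset (EuclideanSpace ℝ (Fin 3)), D'.card = 3 ∧ ∀ r ∈ D', r ∈ X ∧ (∃ k : ℤ, inner ℝ (q - p) n = c k ∧ inner ℝ (r - p) n = c (k - 1)) ∧ dist q r = d) ∧ (∀ r ∈ X, r ≠ q → dist q r < 1 → (inner ℝ (r - p) n = inner ℝ (q - p) n → dist q r = d) ∧ (inner ℝ (r - p) n ≠ inner ℝ (q - p) n → dist q r = d))))) → ∃ s : ℤ → ℤ, Literature.MathematicalPhysics.StatisticalMechanics.IsHaggSeq s ∧ ∃ g : EuclideanSpace ℝ (Fin 3) ≃ᵢ EuclideanSpace ℝ (Fin 3), X = g '' Literature.MathematicalPhysics.StatisticalMechanics.barlowStacking d (√(d ^ 2 - d ^ 2 / 3)) s) → (∀ (X : Set (EuclideanSpace ℝ (Fin 3))) (a b : ℝ) (n : EuclideanSpace ℝ (Fin 3)), X.Nonempty → (∀ p ∈ X, (∃ c : ℤ → ℝ, (19 / 20 ≤ a ∧ a ≤ 1 ∧ 19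 / 20 ≤ b ∧ b ≤ 1 ∧ ‖n‖ = 1 ∧ c 0 = 0 ∧ (∀ k : ℤ, c k + 19 / 25 ≤ c (k + 1)) ∧ (∀ q ∈ X, ∀ r ∈ X, q ≠ r → 19 / 20 ≤ dist q r) ∧ (∀ q ∈ X, dist q p < 2 → ∃ k : ℤ, inner ℝ (q - p) n = c k) ∧ (∃ H U D : Finset (EuclideanSpace ℝ (Fin 3)), H.card = 6 ∧ U.card = 3 ∧ D.card = 3 ∧ (∀ q ∈ H, q ∈ X ∧ inner ℝ (q - p) n = 0 ∧ dist p q = a) ∧ (∀ q ∈ U, q ∈ X ∧ inner ℝ (q - p) n = c 1 ∧ dist p q = b) ∧ (∀ q ∈ D, q ∈ X ∧ inner ℝ (q - p) n = c (-1) ∧ dist p q = b) ∧ (∀ q ∈ X, q ≠ p → dist q p ≤ 1 → q ∈ H ∨ q ∈ U ∨ q ∈ D)) ∧ (∀ q ∈ X, q ≠ p → dist q p ≤ 1 → (∃ H' : Finset (EuclideanSpace ℝ (Fin 3)), H'.card = 6 ∧ ∀ r ∈ H', r ∈ X ∧ r ≠ q ∧ inner ℝ (r - p) n = inner ℝ (q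 - p) n ∧ dist q r = a) ∧ (∃ U' : Finset (EuclideanSpace ℝ (Fin 3)), U'.card = 3 ∧ ∀ r ∈ U', r ∈ X ∧ (∃ k : ℤ, inner ℝ (q - p) n = c k ∧ inner ℝ (r - p) n = c (k + 1)) ∧ dist q r = b) ∧ (∃ D' : Finset (EuclideanSpace ℝ (Fin 3)), D'.card = 3 ∧ ∀ r ∈ D', r ∈ X ∧ (∃ k : ℤ, inner ℝ (q - p) n = c k ∧ inner ℝ (r - p) n = c (k - 1)) ∧ dist q r = b) ∧ (∀ r ∈ X, r ≠ q → dist q r < 1 → (inner ℝ (r - p) n = inner ℝ (q - p) n → dist q r = a) ∧ (inner ℝ (r - p) n ≠ inner ℝ (q - p) n → dist q r = b))))) ∨ (∃ c : ℤ → ℝ, (19 / 20 ≤ a ∧ a ≤ 1 ∧ 19 / 20 ≤ b ∧ b ≤ 1 ∧ ‖(-n)‖ = 1 ∧ c 0 = 0 ∧ (∀ k : ℤ, c k + 19 / 25 ≤ c (k + 1)) ∧ (∀ q ∈ X, ∀ r ∈ X, q ≠ r → 19 / 20 ≤ dist q r) ∧ (∀ q ∈ X, dist q p < 2 → ∃ k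 : ℤ, inner ℝ (q - p) (-n) = c k) ∧ (∃ H U D : Finset (EuclideanSpace ℝ (Fin 3)), H.card = 6 ∧ U.card = 3 ∧ D.card = 3 ∧ (∀ q ∈ H, q ∈ X ∧ inner ℝ (q - p) (-n) = 0 ∧ dist p q = a) ∧ (∀ q ∈ U, q ∈ X ∧ inner ℝ (q - p) (-n) = c 1 ∧ dist p q = b) ∧ (∀ q ∈ D, q ∈ X ∧ inner ℝ (q - p) (-n) = c (-1) ∧ dist p q = b) ∧ (∀ q ∈ X, q ≠ p → dist q p ≤ 1 → q ∈ H ∨ q ∈ U ∨ q ∈ D)) ∧ (∀ q ∈ X, q ≠ p → dist q p ≤ 1 → (∃ H' : Finset (EuclideanSpace ℝ (Fin 3)), H'.card = 6 ∧ ∀ r ∈ H', r ∈ X ∧ r ≠ q ∧ inner ℝ (r - p) (-n) = inner ℝ (q - p) (-n) ∧ dist q r = a) ∧ (∃ U' : Finset (EuclideanSpace ℝ (Fin 3)), U'.card = 3 ∧ ∀ r ∈ U', r ∈ X ∧ (∃ k : ℤ, inner ℝ (q - p) (-n) = c k ∧ inner ℝ (r - p) (-n) = c (k + 1)) ∧ dist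 q r = b) ∧ (∃ D' : Finset (EuclideanSpace ℝ (Fin 3)), D'.card = 3 ∧ ∀ r ∈ D', r ∈ X ∧ (∃ k : ℤ, inner ℝ (q - p) (-n) = c k ∧ inner ℝ (r - p) (-n) = c (k - 1)) ∧ dist q r = b) ∧ (∀ r ∈ X, r ≠ q → dist q r < 1 → (inner ℝ (r - p) (-n) = inner ℝ (q - p) (-n) → dist q r = a) ∧ (inner ℝ (r - p) (-n) ≠ inner ℝ (q - p) (-n) → dist q r = b)))))) → ∃ s : ℤ → ℤ, Literature.MathematicalPhysics.StatisticalMechanics.IsHaggSeq s ∧ ∃ g : EuclideanSpace ℝ (Fin 3) ≃ᵢ EuclideanSpace ℝ (Fin 3), X = g '' Literature.MathematicalPhysics.StatisticalMechanics.barlowStacking a (√(b ^ 2 - a ^ 2 / 3)) s) → (∀ (X : Set (EuclideanSpace ℝ (Fin 3))) (p q : EuclideanSpace ℝ (Fin 3)) (a b a' b' : ℝ) (n n' : EuclideanSpace ℝ (Fin 3)) (c c' : ℤ → ℝ), p ∈ X → q ∈ X → p ≠ q → dist p q ≤ 1 → (19 / 20 ≤ a ∧ a ≤ 1 ∧ 19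 / 20 ≤ b ∧ b ≤ 1 ∧ ‖n‖ = 1 ∧ c 0 = 0 ∧ (∀ k : ℤ, c k + 19 / 25 ≤ c (k + 1)) ∧ (∀ q ∈ X, ∀ r ∈ X, q ≠ r → 19 / 20 ≤ dist q r) ∧ (∀ q ∈ X, dist q p < 2 → ∃ k : ℤ, inner ℝ (q - p) n = c k) ∧ (∃ H U D : Finset (EuclideanSpace ℝ (Fin 3)), H.card = 6 ∧ U.card = 3 ∧ D.card = 3 ∧ (∀ q ∈ H, q ∈ X ∧ inner ℝ (q - p) n = 0 ∧ dist p q = a) ∧ (∀ q ∈ U, q ∈ X ∧ inner ℝ (q - p) n = c 1 ∧ dist p q = b) ∧ (∀ q ∈ D, q ∈ X ∧ inner ℝ (q - p) n = c (-1) ∧ dist p q = b) ∧ (∀ q ∈ X, q ≠ p → dist q p ≤ 1 → q ∈ H ∨ q ∈ U ∨ q ∈ D)) ∧ (∀ q ∈ X, q ≠ p → dist q p ≤ 1 → (∃ H' : Finset (EuclideanSpace ℝ (Fin 3)), H'.card = 6 ∧ ∀ r ∈ H', r ∈ X ∧ r ≠ q ∧ inner ℝ (r - p) n = inner ℝ (q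 - p) n ∧ dist q r = a) ∧ (∃ U' : Finset (EuclideanSpace ℝ (Fin 3)), U'.card = 3 ∧ ∀ r ∈ U', r ∈ X ∧ (∃ k : ℤ, inner ℝ (q - p) n = c k ∧ inner ℝ (r - p) n = c (k + 1)) ∧ dist q r = b) ∧ (∃ D' : Finset (EuclideanSpace ℝ (Fin 3)), D'.card = 3 ∧ ∀ r ∈ D', r ∈ X ∧ (∃ k : ℤ, inner ℝ (q - p) n = c k ∧ inner ℝ (r - p) n = c (k - 1)) ∧ dist q r = b) ∧ (∀ r ∈ X, r ≠ q → dist q r < 1 → (inner ℝ (r - p) n = inner ℝ (q - p) n → dist q r = a) ∧ (inner ℝ (r - p) n ≠ inner ℝ (q - p) n → dist q r = b)))) → (19 / 20 ≤ a' ∧ a' ≤ 1 ∧ 19 / 20 ≤ b' ∧ b' ≤ 1 ∧ ‖n'‖ = 1 ∧ c' 0 = 0 ∧ (∀ k : ℤ, c' k + 19 / 25 ≤ c' (k + 1)) ∧ (∀ r ∈ X, ∀ t ∈ X, r ≠ t → 19 / 20 ≤ dist r t) ∧ (∀ r ∈ X, dist r q < 2 → ∃ k : ℤ, inner ℝ (r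 - q) n' = c' k) ∧ (∃ H U D : Finset (EuclideanSpace ℝ (Fin 3)), H.card = 6 ∧ U.card = 3 ∧ D.card = 3 ∧ (∀ r ∈ H, r ∈ X ∧ inner ℝ (r - q) n' = 0 ∧ dist q r = a') ∧ (∀ r ∈ U, r ∈ X ∧ inner ℝ (r - q) n' = c' 1 ∧ dist q r = b') ∧ (∀ r ∈ D, r ∈ X ∧ inner ℝ (r - q) n' = c' (-1) ∧ dist q r = b') ∧ (∀ r ∈ X, r ≠ q → dist r q ≤ 1 → r ∈ H ∨ r ∈ U ∨ r ∈ D)) ∧ (∀ r ∈ X, r ≠ q → dist r q ≤ 1 → (∃ H' : Finset (EuclideanSpace ℝ (Fin 3)), H'.card = 6 ∧ ∀ t ∈ H', t ∈ X ∧ t ≠ r ∧ inner ℝ (t - q) n' = inner ℝ (r - q) n' ∧ dist r t = a') ∧ (∃ U' : Finset (EuclideanSpace ℝ (Fin 3)), U'.card = 3 ∧ ∀ t ∈ U', t ∈ X ∧ (∃ k : ℤ, inner ℝ (r - q) n' = c' k ∧ inner ℝ (t - q) n' = c' (k + 1)) ∧ dist r t = b') ∧ (∃ D' : Finset (EuclideanSpace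 ℝ (Fin 3)), D'.card = 3 ∧ ∀ t ∈ D', t ∈ X ∧ (∃ k : ℤ, inner ℝ (r - q) n' = c' k ∧ inner ℝ (t - q) n' = c' (k - 1)) ∧ dist r t = b') ∧ (∀ t ∈ X, t ≠ r → dist r t < 1 → (inner ℝ (t - q) n' = inner ℝ (r - q) n' → dist r t = a') ∧ (inner ℝ (t - q) n' ≠ inner ℝ (r - q) n' → dist r t = b')))) → a' = a ∧ b' = b ∧ (a ≠ b → (n' = n ∨ n' = -n))) → ∀ R ε : ℝ, 0 < ε → ∃ m : ℕ, ∀ (N : ℕ) (y : Fin N → EuclideanSpace ℝ (Fin 3)) (i : Fin N), (∀ jc : Fin N, dist (y jc) (y i) ≤ (m : ℝ) → (∃ a b : ℝ, 19 / 20 ≤ a ∧ a ≤ 1 ∧ 19 / 20 ≤ b ∧ b ≤ 1 ∧ ∃ n : EuclideanSpace ℝ (Fin 3), ‖n‖ = 1 ∧ ∃ c : ℤ → ℝ, (∀ k : ℤ, c k + 19 / 25 ≤ c (k + 1)) ∧ ∃ l : Fin N → ℤ, (∀ j : Fin N, dist (y j) (y jc) ≤ 2 → |inner ℝ (y j - y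 jc) n - c (l j)| ≤ 1 / ((m : ℝ) + 1)) ∧ (∀ j k : Fin N, dist (y j) (y jc) ≤ 2 → dist (y k) (y jc) ≤ 2 → j ≠ k → 19 / 20 ≤ dist (y j) (y k)) ∧ ∀ j : Fin N, dist (y j) (y jc) ≤ 1 → Nat.card {k : Fin N // k ≠ j ∧ l k = l j ∧ dist (y j) (y k) ≤ 1} = 6 ∧ Nat.card {k : Fin N // l k = l j + 1 ∧ dist (y j) (y k) ≤ 1} = 3 ∧ Nat.card {k : Fin N // l k = l j - 1 ∧ dist (y j) (y k) ≤ 1} = 3 ∧ ∀ k : Fin N, k ≠ j → dist (y j) (y k) ≤ 1 → (l k = l j → |dist (y j) (y k) - a| ≤ 1 / ((m : ℝ) + 1)) ∧ (l k ≠ l j → |dist (y j) (y k) - b| ≤ 1 / ((m : ℝ) + 1)))) → ∃ a h : ℝ, 1 / 2 < a ∧ a < 2 ∧ 1 / 2 < h ∧ h < 2 ∧ ∃ s : ℤ → ℤ, Literature.MathematicalPhysics.StatisticalMechanics.IsHaggSeq s ∧ ∃ z ∈ Literature.MathematicalPhysics.StatisticalMechanics.barlowStacking a h s, ∃ A : EuclideanSpace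 ℝ (Fin 3) →ₗᵢ[ℝ] EuclideanSpace ℝ (Fin 3), (∀ p ∈ Literature.MathematicalPhysics.StatisticalMechanics.barlowStacking a h s, dist p z ≤ R → ∃ j : Fin N, dist (y j) (y i + A (p - z)) ≤ ε) ∧ (∀ j : Fin N, dist (y j) (y i) ≤ R → ∃ p ∈ Literature.MathematicalPhysics.StatisticalMechanics.barlowStacking a h s, dist (y j) (y i + A (p - z)) ≤ ε) := by
  intro hS0 hS12 hS3 hS4 R ε hε
  by_contra hcon
  have H : ∀ m : ℕ, ∃ (N : ℕ) (y : Fin N → EuclideanSpace ℝ (Fin 3)) (i : Fin N),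
      (∀ jc : Fin N, dist (y jc) (y i) ≤ (m : ℝ) → (∃ a b : ℝ, 19 / 20 ≤ a ∧ a ≤ 1 ∧ 19 / 20 ≤ b ∧ b ≤ 1 ∧ ∃ n : EuclideanSpace ℝ (Fin 3), ‖n‖ = 1 ∧ ∃ c : ℤ → ℝ, (∀ k : ℤ, c k + 19 / 25 ≤ c (k + 1)) ∧ ∃ l : Fin N → ℤ, (∀ j : Fin N, dist (y j) (y jc) ≤ 2 → |inner ℝ (y j - y jc) n - c (l j)| ≤ 1 / ((m : ℝ) + 1)) ∧ (∀ j k : Fin N, dist (y j) (y jc) ≤ 2 → dist (y k) (y jc) ≤ 2 → j ≠ k → 19 / 20 ≤ dist (y j) (y k)) ∧ ∀ j : Fin N, dist (y j) (y jc) ≤ 1 → Nat.card {k : Fin N // k ≠ j ∧ l k = l j ∧ dist (y j) (y k) ≤ 1} = 6 ∧ Nat.card {k : Fin N // l k = l j + 1 ∧ dist (y j) (y k) ≤ 1} = 3 ∧ Nat.card {k : Fin N // l k = l j - 1 ∧ dist (y j) (y k) ≤ 1} = 3 ∧ ∀ k : Fin N, k ≠ j → dist (y j) (y k) ≤ 1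 → (l k = l j → |dist (y j) (y k) - a| ≤ 1 / ((m : ℝ) + 1)) ∧ (l k ≠ l j → |dist (y j) (y k) - b| ≤ 1 / ((m : ℝ) + 1)))) ∧
      ¬ (∃ a h : ℝ, 1 / 2 < a ∧ a < 2 ∧ 1 / 2 < h ∧ h < 2 ∧ ∃ s : ℤ → ℤ, Literature.MathematicalPhysics.StatisticalMechanics.IsHaggSeq s ∧ ∃ z ∈ Literature.MathematicalPhysics.StatisticalMechanics.barlowStacking a h s, ∃ A : EuclideanSpace ℝ (Fin 3) →ₗᵢ[ℝ] EuclideanSpace ℝ (Fin 3), (∀ p ∈ Literature.MathematicalPhysics.StatisticalMechanics.barlowStacking a h s, dist p z ≤ R → ∃ j : Fin N, dist (y j) (y i + A (p - z)) ≤ ε) ∧ (∀ j : Fin N, dist (y j) (y i) ≤ R → ∃ p ∈ Literature.MathematicalPhysics.StatisticalMechanics.barlowStacking a h s, dist (y j) (y i + A (p - z)) ≤ ε)) := by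
    intro m
    by_contra hm
    exact hcon ⟨m, fun N y i hg => by_contra fun hb => hm ⟨N, y, i, hg, hb⟩⟩
  choose Nk yk ik hgood hbad using H
  obtain ⟨φ, X, hφ, hlim, h0, hfr⟩ := hS0 Nk yk ik hgood
  obtain ⟨a, h, ha1, ha2, hh1, hh2, s, hs, g, hXeq⟩ := barlow_of_localFrames hS12 hS3 hS4 X h0 hfr
  -- the stacking point under `0` and the linear part of `g`
  have hz0 : g.symm 0 ∈ barlowStacking a h s := by
    have : (0 : EuclideanSpace ℝ (Fin 3)) ∈ g '' barlowStacking a h s := hXeq ▸ h0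
    obtain ⟨z, hz, hz0⟩ := this
    rwa [← hz0, IsometryEquiv.symm_apply_apply]
  set z₀ := g.symm 0 with hz₀def
  set L := g.toRealLinearIsometryEquiv with hLdef
  have hgz : g z₀ = 0 := by rw [hz₀def, IsometryEquiv.apply_symm_apply]
  have hgp : ∀ p, g p = L (p - z₀) := fun p => by
    rw [isometryEquiv_apply_eq g p z₀, hgz, zero_add]
  -- read back at a scale `k` with `φ k ≥ R`
  obtain ⟨k, hk, hkR⟩ := ((hlim R ε hε).and (Filter.eventually_ge_atTop ⌈R⌉₊)).exists
  have hkR' : R ≤ (φ k : ℝ) := by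
    have h1 : R ≤ (⌈R⌉₊ : ℝ) := Nat.le_ceil R
    have h2 : (⌈R⌉₊ : ℝ) ≤ (k : ℝ) := by exact_mod_cast hkR
    have h3 : (k : ℝ) ≤ (φ k : ℝ) := by exact_mod_cast hφ.id_le k
    linarith
  apply hbad (φ k)
  refine ⟨a, h, ha1, ha2, hh1, hh2, s, hs, z₀, hz0, L.toLinearIsometry, ?_, ?_⟩
  · intro p hp hpR
    have hgpX : g p ∈ X := by rw [hXeq]; exact ⟨p, hp, rfl⟩
    have hgp0 : dist (g p) 0 ≤ R := by rw [← hgz, g.dist_eq]; exact hpR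
    obtain ⟨w, ⟨j, hj, rfl⟩, hw⟩ := hk.1 (g p) hgpX hgp0
    refine ⟨j, ?_⟩
    have : yk (φ k) (ik (φ k)) + L.toLinearIsometry (p - z₀) = yk (φ k) (ik (φ k)) + g p := by
      rw [hgp p]; rfl
    rw [this]
    calc dist (yk (φ k) j) (yk (φ k) (ik (φ k)) + g p)
        = dist (yk (φ k) j - yk (φ k) (ik (φ k))) (g p) := by
          rw [dist_eq_norm, dist_eq_norm]; congr 1; abel
      _ ≤ ε := hw
  · intro j hj
    have hmem : yk (φ k) j - yk (φ k) (ik (φ k)) ∈ {p | ∃ j : Fin (Nk (φ k)),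
        dist (yk (φ k) j) (yk (φ k) (ik (φ k))) ≤ (φ k : ℝ) ∧ p = yk (φ k) j - yk (φ k) (ik (φ k))} :=
      ⟨j, hj.trans hkR', rfl⟩
    have hnorm : dist (yk (φ k) j - yk (φ k) (ik (φ k))) 0 ≤ R := by
      rw [dist_zero_right, ← dist_eq_norm]; exact hj
    obtain ⟨x, hxX, hx⟩ := hk.2 _ hmem hnorm
    rw [hXeq] at hxX
    obtain ⟨p, hp, rfl⟩ := hxX
    refine ⟨p, hp, ?_⟩
    have : yk (φ k) (ik (φ k)) + L.toLinearIsometry (p - z₀) = yk (φ k) (ik (φ k)) + g p := by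
      rw [hgp p]; rfl
    rw [this]
    calc dist (yk (φ k) j) (yk (φ k) (ik (φ k)) + g p)
        = dist (yk (φ k) j - yk (φ k) (ik (φ k))) (g p) := by
          rw [dist_eq_norm, dist_eq_norm]; congr 1; abel
      _ ≤ ε := hx

/-- **The registered stub `stub_leadGlue` of the line `Sketch` (reshape 11), by name and signature:** local
rigidity (`localRigidity_of_stubs`) fed into the counting side (`laminarBarlowWindows_of_localRigidity`).
[folklore] -/
theorem stub_leadGlue :
    (∀ (Nk : ℕ → ℕ) (y : (m : ℕ) → Fin (Nk m) → EuclideanSpace ℝ (Fin 3)) (ik : (m : ℕ) → Fin (Nk m)), (∀ (m : ℕ) (jc : Fin (Nk m)), dist (y m jc) (y m (ik m)) ≤ (m : ℝ) → (∃ a b : ℝ, 19 / 20 ≤ a ∧ a ≤ 1 ∧ 19 / 20 ≤ b ∧ b ≤ 1 ∧ ∃ n : EuclideanSpace ℝ (Fin 3), ‖n‖ = 1 ∧ ∃ c : ℤ → ℝ, (∀ k : ℤ, c k + 19 / 25 ≤ c (k + 1)) ∧ ∃ l : Fin (Nk m) → ℤ, (∀ j : Fin (Nk m), dist (y m j) (y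 m jc) ≤ 2 → |inner ℝ (y m j - y m jc) n - c (l j)| ≤ 1 / ((m : ℝ) + 1)) ∧ (∀ j k : Fin (Nk m), dist (y m j) (y m jc) ≤ 2 → dist (y m k) (y m jc) ≤ 2 → j ≠ k → 19 / 20 ≤ dist (y m j) (y m k)) ∧ ∀ j : Fin (Nk m), dist (y m j) (y m jc) ≤ 1 → Nat.card {k : Fin (Nk m) // k ≠ j ∧ l k = l j ∧ dist (y m j) (y m k) ≤ 1} = 6 ∧ Nat.card {k : Fin (Nk m) // l k = l j + 1 ∧ dist (y m j) (y m k) ≤ 1} = 3 ∧ Nat.card {k : Fin (Nk m) // l k = l j - 1 ∧ dist (y m j) (y m k) ≤ 1} = 3 ∧ ∀ k : Fin (Nk m), k ≠ j → dist (y m j) (y m k) ≤ 1 → (l k = l j → |dist (y m j) (y m k) - a| ≤ 1 / ((m : ℝ) + 1)) ∧ (l k ≠ l j → |dist (y m j) (y m k) - b| ≤ 1 / ((m : ℝ) + 1)))) → ∃ (φ : ℕ → ℕ) (X : Set (EuclideanSpace ℝ (Fin 3))), StrictMono φ ∧ (∀ R δ : ℝ, 0 < δ → ∀ᶠ k in Filter.atTop,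 Literature.MathematicalPhysics.StatisticalMechanics.BallMatch δ R 0 {p | ∃ j : Fin (Nk (φ k)), dist (y (φ k) j) (y (φ k) (ik (φ k))) ≤ (φ k : ℝ) ∧ p = y (φ k) j - y (φ k) (ik (φ k))} X) ∧ (0 : EuclideanSpace ℝ (Fin 3)) ∈ X ∧ ∀ p ∈ X, ∃ (a b : ℝ) (n : EuclideanSpace ℝ (Fin 3)) (c : ℤ → ℝ), (19 / 20 ≤ a ∧ a ≤ 1 ∧ 19 / 20 ≤ b ∧ b ≤ 1 ∧ ‖n‖ = 1 ∧ c 0 = 0 ∧ (∀ k : ℤ, c k + 19 / 25 ≤ c (k + 1)) ∧ (∀ q ∈ X, ∀ r ∈ X, q ≠ r → 19 / 20 ≤ dist q r) ∧ (∀ q ∈ X, dist q p < 2 → ∃ k : ℤ, inner ℝ (q - p) n = c k) ∧ (∃ H U D : Finset (EuclideanSpace ℝ (Fin 3)), H.card = 6 ∧ U.card = 3 ∧ D.card = 3 ∧ (∀ q ∈ H, q ∈ X ∧ inner ℝ (q - p) n = 0 ∧ dist p q = a) ∧ (∀ q ∈ U, q ∈ X ∧ inner ℝ (q - p) n = c 1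 ∧ dist p q = b) ∧ (∀ q ∈ D, q ∈ X ∧ inner ℝ (q - p) n = c (-1) ∧ dist p q = b) ∧ (∀ q ∈ X, q ≠ p → dist q p ≤ 1 → q ∈ H ∨ q ∈ U ∨ q ∈ D)) ∧ (∀ q ∈ X, q ≠ p → dist q p ≤ 1 → (∃ H' : Finset (EuclideanSpace ℝ (Fin 3)), H'.card = 6 ∧ ∀ r ∈ H', r ∈ X ∧ r ≠ q ∧ inner ℝ (r - p) n = inner ℝ (q - p) n ∧ dist q r = a) ∧ (∃ U' : Finset (EuclideanSpace ℝ (Fin 3)), U'.card = 3 ∧ ∀ r ∈ U', r ∈ X ∧ (∃ k : ℤ, inner ℝ (q - p) n = c k ∧ inner ℝ (r - p) n = c (k + 1)) ∧ dist q r = b) ∧ (∃ D' : Finset (EuclideanSpace ℝ (Fin 3)), D'.card = 3 ∧ ∀ r ∈ D', r ∈ X ∧ (∃ k : ℤ, inner ℝ (q - p) n = c k ∧ inner ℝ (r - p) n = c (k - 1)) ∧ dist q r = b) ∧ (∀ r ∈ X, r ≠ q → dist q r < 1 → (inner ℝ (r - p) n = inner ℝ (q - p) n → dist q r = a) ∧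 (inner ℝ (r - p) n ≠ inner ℝ (q - p) n → dist q r = b))))) → (∀ (X : Set (EuclideanSpace ℝ (Fin 3))) (d : ℝ), X.Nonempty → (∀ p ∈ X, ∃ (n : EuclideanSpace ℝ (Fin 3)) (c : ℤ → ℝ), (19 / 20 ≤ d ∧ d ≤ 1 ∧ 19 / 20 ≤ d ∧ d ≤ 1 ∧ ‖n‖ = 1 ∧ c 0 = 0 ∧ (∀ k : ℤ, c k + 19 / 25 ≤ c (k + 1)) ∧ (∀ q ∈ X, ∀ r ∈ X, q ≠ r → 19 / 20 ≤ dist q r) ∧ (∀ q ∈ X, dist q p < 2 → ∃ k : ℤ, inner ℝ (q - p) n = c k) ∧ (∃ H U D : Finset (EuclideanSpace ℝ (Fin 3)), H.card = 6 ∧ U.card = 3 ∧ D.card = 3 ∧ (∀ q ∈ H, q ∈ X ∧ inner ℝ (q - p) n = 0 ∧ dist p q = d) ∧ (∀ q ∈ U, q ∈ X ∧ inner ℝ (q - p) n = c 1 ∧ dist p q = d) ∧ (∀ q ∈ D, q ∈ X ∧ inner ℝ (q - p) n = c (-1) ∧ dist p q = d) ∧ (∀ q ∈ X, q ≠ p →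 dist q p ≤ 1 → q ∈ H ∨ q ∈ U ∨ q ∈ D)) ∧ (∀ q ∈ X, q ≠ p → dist q p ≤ 1 → (∃ H' : Finset (EuclideanSpace ℝ (Fin 3)), H'.card = 6 ∧ ∀ r ∈ H', r ∈ X ∧ r ≠ q ∧ inner ℝ (r - p) n = inner ℝ (q - p) n ∧ dist q r = d) ∧ (∃ U' : Finset (EuclideanSpace ℝ (Fin 3)), U'.card = 3 ∧ ∀ r ∈ U', r ∈ X ∧ (∃ k : ℤ, inner ℝ (q - p) n = c k ∧ inner ℝ (r - p) n = c (k + 1)) ∧ dist q r = d) ∧ (∃ D' : Finset (EuclideanSpace ℝ (Fin 3)), D'.card = 3 ∧ ∀ r ∈ D', r ∈ X ∧ (∃ k : ℤ, inner ℝ (q - p) n = c k ∧ inner ℝ (r - p) n = c (k - 1)) ∧ dist q r = d) ∧ (∀ r ∈ X, r ≠ q → dist q r < 1 → (inner ℝ (r - p) n = inner ℝ (q - p) n → dist q r = d) ∧ (inner ℝ (r - p) n ≠ inner ℝ (q - p) n → dist q r = d))))) → ∃ s : ℤ → ℤ, Literature.MathematicalPhysics.StatisticalMechanics.IsHaggSeq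 s ∧ ∃ g : EuclideanSpace ℝ (Fin 3) ≃ᵢ EuclideanSpace ℝ (Fin 3), X = g '' Literature.MathematicalPhysics.StatisticalMechanics.barlowStacking d (√(d ^ 2 - d ^ 2 / 3)) s) → (∀ (X : Set (EuclideanSpace ℝ (Fin 3))) (a b : ℝ) (n : EuclideanSpace ℝ (Fin 3)), X.Nonempty → (∀ p ∈ X, (∃ c : ℤ → ℝ, (19 / 20 ≤ a ∧ a ≤ 1 ∧ 19 / 20 ≤ b ∧ b ≤ 1 ∧ ‖n‖ = 1 ∧ c 0 = 0 ∧ (∀ k : ℤ, c k + 19 / 25 ≤ c (k + 1)) ∧ (∀ q ∈ X, ∀ r ∈ X, q ≠ r → 19 / 20 ≤ dist q r) ∧ (∀ q ∈ X, dist q p < 2 → ∃ k : ℤ, inner ℝ (q - p) n = c k) ∧ (∃ H U D : Finset (EuclideanSpace ℝ (Fin 3)), H.card = 6 ∧ U.card = 3 ∧ D.card = 3 ∧ (∀ q ∈ H, q ∈ X ∧ inner ℝ (q - p) n = 0 ∧ dist p q = a) ∧ (∀ q ∈ U, q ∈ X ∧ inner ℝ (q - p) n = c 1 ∧ dist p q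 = b) ∧ (∀ q ∈ D, q ∈ X ∧ inner ℝ (q - p) n = c (-1) ∧ dist p q = b) ∧ (∀ q ∈ X, q ≠ p → dist q p ≤ 1 → q ∈ H ∨ q ∈ U ∨ q ∈ D)) ∧ (∀ q ∈ X, q ≠ p → dist q p ≤ 1 → (∃ H' : Finset (EuclideanSpace ℝ (Fin 3)), H'.card = 6 ∧ ∀ r ∈ H', r ∈ X ∧ r ≠ q ∧ inner ℝ (r - p) n = inner ℝ (q - p) n ∧ dist q r = a) ∧ (∃ U' : Finset (EuclideanSpace ℝ (Fin 3)), U'.card = 3 ∧ ∀ r ∈ U', r ∈ X ∧ (∃ k : ℤ, inner ℝ (q - p) n = c k ∧ inner ℝ (r - p) n = c (k + 1)) ∧ dist q r = b) ∧ (∃ D' : Finset (EuclideanSpace ℝ (Fin 3)), D'.card = 3 ∧ ∀ r ∈ D', r ∈ X ∧ (∃ k : ℤ, inner ℝ (q - p) n = c k ∧ inner ℝ (r - p) n = c (k - 1)) ∧ dist q r = b) ∧ (∀ r ∈ X, r ≠ q → dist q r < 1 → (inner ℝ (r - p) n = inner ℝ (q - p) n → dist q r = a) ∧ (inner ℝ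 (r - p) n ≠ inner ℝ (q - p) n → dist q r = b))))) ∨ (∃ c : ℤ → ℝ, (19 / 20 ≤ a ∧ a ≤ 1 ∧ 19 / 20 ≤ b ∧ b ≤ 1 ∧ ‖(-n)‖ = 1 ∧ c 0 = 0 ∧ (∀ k : ℤ, c k + 19 / 25 ≤ c (k + 1)) ∧ (∀ q ∈ X, ∀ r ∈ X, q ≠ r → 19 / 20 ≤ dist q r) ∧ (∀ q ∈ X, dist q p < 2 → ∃ k : ℤ, inner ℝ (q - p) (-n) = c k) ∧ (∃ H U D : Finset (EuclideanSpace ℝ (Fin 3)), H.card = 6 ∧ U.card = 3 ∧ D.card = 3 ∧ (∀ q ∈ H, q ∈ X ∧ inner ℝ (q - p) (-n) = 0 ∧ dist p q = a) ∧ (∀ q ∈ U, q ∈ X ∧ inner ℝ (q - p) (-n) = c 1 ∧ dist p q = b) ∧ (∀ q ∈ D, q ∈ X ∧ inner ℝ (q - p) (-n) = c (-1) ∧ dist p q = b) ∧ (∀ q ∈ X, q ≠ p → dist q p ≤ 1 → q ∈ H ∨ q ∈ U ∨ q ∈ D)) ∧ (∀ q ∈ X, q ≠ p → dist q p ≤ 1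 → (∃ H' : Finset (EuclideanSpace ℝ (Fin 3)), H'.card = 6 ∧ ∀ r ∈ H', r ∈ X ∧ r ≠ q ∧ inner ℝ (r - p) (-n) = inner ℝ (q - p) (-n) ∧ dist q r = a) ∧ (∃ U' : Finset (EuclideanSpace ℝ (Fin 3)), U'.card = 3 ∧ ∀ r ∈ U', r ∈ X ∧ (∃ k : ℤ, inner ℝ (q - p) (-n) = c k ∧ inner ℝ (r - p) (-n) = c (k + 1)) ∧ dist q r = b) ∧ (∃ D' : Finset (EuclideanSpace ℝ (Fin 3)), D'.card = 3 ∧ ∀ r ∈ D', r ∈ X ∧ (∃ k : ℤ, inner ℝ (q - p) (-n) = c k ∧ inner ℝ (r - p) (-n) = c (k - 1)) ∧ dist q r = b) ∧ (∀ r ∈ X, r ≠ q → dist q r < 1 → (inner ℝ (r - p) (-n) = inner ℝ (q - p) (-n) → dist q r = a) ∧ (inner ℝ (r - p) (-n) ≠ inner ℝ (q - p) (-n) → dist q r = b)))))) → ∃ s : ℤ → ℤ, Literature.MathematicalPhysics.StatisticalMechanics.IsHaggSeq s ∧ ∃ g : EuclideanSpace ℝ (Fin 3) ≃ᵢ EuclideanSpace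 ℝ (Fin 3), X = g '' Literature.MathematicalPhysics.StatisticalMechanics.barlowStacking a (√(b ^ 2 - a ^ 2 / 3)) s) → (∀ (X : Set (EuclideanSpace ℝ (Fin 3))) (p q : EuclideanSpace ℝ (Fin 3)) (a b a' b' : ℝ) (n n' : EuclideanSpace ℝ (Fin 3)) (c c' : ℤ → ℝ), p ∈ X → q ∈ X → p ≠ q → dist p q ≤ 1 → (19 / 20 ≤ a ∧ a ≤ 1 ∧ 19 / 20 ≤ b ∧ b ≤ 1 ∧ ‖n‖ = 1 ∧ c 0 = 0 ∧ (∀ k : ℤ, c k + 19 / 25 ≤ c (k + 1)) ∧ (∀ q ∈ X, ∀ r ∈ X, q ≠ r → 19 / 20 ≤ dist q r) ∧ (∀ q ∈ X, dist q p < 2 → ∃ k : ℤ, inner ℝ (q - p) n = c k) ∧ (∃ H U D : Finset (EuclideanSpace ℝ (Fin 3)), H.card = 6 ∧ U.card = 3 ∧ D.card = 3 ∧ (∀ q ∈ H, q ∈ X ∧ inner ℝ (q - p) n = 0 ∧ dist p q = a) ∧ (∀ q ∈ U, q ∈ X ∧ inner ℝ (q - p) n = c 1 ∧ dist p q = b)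 ∧ (∀ q ∈ D, q ∈ X ∧ inner ℝ (q - p) n = c (-1) ∧ dist p q = b) ∧ (∀ q ∈ X, q ≠ p → dist q p ≤ 1 → q ∈ H ∨ q ∈ U ∨ q ∈ D)) ∧ (∀ q ∈ X, q ≠ p → dist q p ≤ 1 → (∃ H' : Finset (EuclideanSpace ℝ (Fin 3)), H'.card = 6 ∧ ∀ r ∈ H', r ∈ X ∧ r ≠ q ∧ inner ℝ (r - p) n = inner ℝ (q - p) n ∧ dist q r = a) ∧ (∃ U' : Finset (EuclideanSpace ℝ (Fin 3)), U'.card = 3 ∧ ∀ r ∈ U', r ∈ X ∧ (∃ k : ℤ, inner ℝ (q - p) n = c k ∧ inner ℝ (r - p) n = c (k + 1)) ∧ dist q r = b) ∧ (∃ D' : Finset (EuclideanSpace ℝ (Fin 3)), D'.card = 3 ∧ ∀ r ∈ D', r ∈ X ∧ (∃ k : ℤ, inner ℝ (q - p) n = c k ∧ inner ℝ (r - p) n = c (k - 1)) ∧ dist q r = b) ∧ (∀ r ∈ X, r ≠ q → dist q r < 1 → (inner ℝ (r - p) n = inner ℝ (q - p) n → dist q r = a) ∧ (inner ℝ (r -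 p) n ≠ inner ℝ (q - p) n → dist q r = b)))) → (19 / 20 ≤ a' ∧ a' ≤ 1 ∧ 19 / 20 ≤ b' ∧ b' ≤ 1 ∧ ‖n'‖ = 1 ∧ c' 0 = 0 ∧ (∀ k : ℤ, c' k + 19 / 25 ≤ c' (k + 1)) ∧ (∀ r ∈ X, ∀ t ∈ X, r ≠ t → 19 / 20 ≤ dist r t) ∧ (∀ r ∈ X, dist r q < 2 → ∃ k : ℤ, inner ℝ (r - q) n' = c' k) ∧ (∃ H U D : Finset (EuclideanSpace ℝ (Fin 3)), H.card = 6 ∧ U.card = 3 ∧ D.card = 3 ∧ (∀ r ∈ H, r ∈ X ∧ inner ℝ (r - q) n' = 0 ∧ dist q r = a') ∧ (∀ r ∈ U, r ∈ X ∧ inner ℝ (r - q) n' = c' 1 ∧ dist q r = b') ∧ (∀ r ∈ D, r ∈ X ∧ inner ℝ (r - q) n' = c' (-1) ∧ dist q r = b') ∧ (∀ r ∈ X, r ≠ q → dist r q ≤ 1 → r ∈ H ∨ r ∈ U ∨ r ∈ D)) ∧ (∀ r ∈ X, r ≠ q → dist r q ≤ 1 → (∃ H' : Finset (EuclideanSpace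 ℝ (Fin 3)), H'.card = 6 ∧ ∀ t ∈ H', t ∈ X ∧ t ≠ r ∧ inner ℝ (t - q) n' = inner ℝ (r - q) n' ∧ dist r t = a') ∧ (∃ U' : Finset (EuclideanSpace ℝ (Fin 3)), U'.card = 3 ∧ ∀ t ∈ U', t ∈ X ∧ (∃ k : ℤ, inner ℝ (r - q) n' = c' k ∧ inner ℝ (t - q) n' = c' (k + 1)) ∧ dist r t = b') ∧ (∃ D' : Finset (EuclideanSpace ℝ (Fin 3)), D'.card = 3 ∧ ∀ t ∈ D', t ∈ X ∧ (∃ k : ℤ, inner ℝ (r - q) n' = c' k ∧ inner ℝ (t - q) n' = c' (k - 1)) ∧ dist r t = b') ∧ (∀ t ∈ X, t ≠ r → dist r t < 1 → (inner ℝ (t - q) n' = inner ℝ (r - q) n' → dist r t = a') ∧ (inner ℝ (t - q) n' ≠ inner ℝ (r - q) n' → dist r t = b')))) → a' = a ∧ b' = b ∧ (a ≠ b → (n' = n ∨ n' = -n))) → (∀ ε : ℝ, 0 < ε → ∃ t R₀ γ C : ℝ, 0 < t ∧ 0 < R₀ ∧ 0 < γ ∧ 0 ≤ C ∧ ∃ s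 : ℕ → ℝ, Filter.Tendsto (fun N : ℕ => s N / (N : ℝ)) Filter.atTop (nhds 0) ∧ ∀ (N : ℕ) (y : Fin N → EuclideanSpace ℝ (Fin 3)), Literature.MathematicalPhysics.StatisticalMechanics.IsGroundState Literature.MathematicalPhysics.StatisticalMechanics.lennardJones y → γ * (Nat.card {i : Fin N // ¬ (∃ a b : ℝ, 19 / 20 ≤ a ∧ a ≤ 1 ∧ 19 / 20 ≤ b ∧ b ≤ 1 ∧ ∃ n : EuclideanSpace ℝ (Fin 3), ‖n‖ = 1 ∧ ∃ c : ℤ → ℝ, (∀ k : ℤ, c k + 19 / 25 ≤ c (k + 1)) ∧ ∃ l : Fin N → ℤ, (∀ j : Fin N, dist (y j) (y i) ≤ 2 → |inner ℝ (y j - y i) n - c (l j)| ≤ ε) ∧ (∀ j k : Fin N, dist (y j) (y i) ≤ 2 → dist (y k) (y i) ≤ 2 → j ≠ k → 19 / 20 ≤ dist (y j) (y k)) ∧ ∀ j : Fin N, dist (y j) (y i) ≤ 1 → Nat.card {k : Fin N // k ≠ j ∧ l k = l j ∧ dist (y j) (y k) ≤ 1} = 6 ∧ Nat.card {k : Fin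 N // l k = l j + 1 ∧ dist (y j) (y k) ≤ 1} = 3 ∧ Nat.card {k : Fin N // l k = l j - 1 ∧ dist (y j) (y k) ≤ 1} = 3 ∧ ∀ k : Fin N, k ≠ j → dist (y j) (y k) ≤ 1 → (l k = l j → |dist (y j) (y k) - a| ≤ ε) ∧ (l k ≠ l j → |dist (y j) (y k) - b| ≤ ε))} : ℝ) ≤ (Literature.MathematicalPhysics.StatisticalMechanics.interactionEnergy Literature.MathematicalPhysics.StatisticalMechanics.lennardJones y - (N : ℝ) * (⨅ Q : Literature.MathematicalPhysics.StatisticalMechanics.PeriodicConfiguration 3, Q.energyPerParticle Literature.MathematicalPhysics.StatisticalMechanics.lennardJones)) + C * (Nat.card {i : Fin N // ¬ (∃ n : EuclideanSpace ℝ (Fin 3), ‖n‖ = 1 ∧ ∃ c : ℤ → ℝ, (∀ k : ℤ, c k + 3 / 4 ≤ c (k + 1)) ∧ ∀ j : Fin N, dist (y j) (y i) ≤ R₀ → ∃ k : ℤ, |inner ℝ (y j - y i) n - c k| ≤ t)} : ℝ) + s N) → LjLaminarity → LaminarBarlowWindows :=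
  fun hS0 hS12 hS3 hS4 hE hLam =>
    laminarBarlowWindows_of_localRigidity (localRigidity_of_stubs hS0 hS12 hS3 hS4) hE hLam

end Summit.AtomisticToContinuum.Crystallization.Theorems.SquareWellLayerCake.StackingFaultSparsity.LocalFrames.Final

end
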